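import Literature.Geometry.Lorentzian.KerrBoyerLindquistLeafDifferential
import HarnessLib

/-!
# The Boyer–Lindquist slice of Kerr as a map from quasi-isotropic Cartesian coordinates, III:
# the leaf as a smooth spacelike immersion and its induced metric everywhere

Support file (all results proved; no named facts), step 5 of the statement that the
Boyer–Lindquist slice of Kerr is an exact Kerr leaf with Dafermos–Rodnianski-admissible
asymptotics. The leaf map `Kerr.BL.leafRep M a b` (`…LeafMap.lean`) restricted to the exterior
`Kerr.slice 0 ρ₁ = {‖x‖ > max ρ₁ 0}` of the quasi-isotropic threshold (`ρ₁ ≥ ρH`, `0 ≤ M`) is a map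

  `Kerr.BL.leaf M a b ρ₁ hM hρ₁ : Kerr.slice 0 ρ₁ → Kerr.region a 0`

into the ingoing Kerr–Schild chart (`radius = R(‖x‖) > 0`, `radius_leafRep`). We prove it is
`C^∞` (`contMDiff_leaf`), compute its differential (`mfderiv_leaf_apply`), extend the off-axis
identification of the induced metric with the closed form `blHRep = (Σ/ρ²)δ + (a²(Σ+2MR)/Σ)ϖ⊗ϖ`
(`bilin_fderiv_leafRep`, step 4) **to the axis by continuity** (`bilin_fderiv_leafRep_of_mem`,
`Kerr.eqOn_slice_of_offAxis`: both sides are continuous on the open slice and agree on its dense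
off-axis part), and conclude that **the leaf is a spacelike immersion**
(`isSpacelikeImmersion_leaf`: `blHRep(v, v) ≥ (Σ/ρ²)‖v‖² > 0`).

References: Brandt–Seidel, Phys. Rev. D 54 (1996) 1403, §II; Boyer–Lindquist 1967; Visser
arXiv:0706.0622, §4–§5; O'Neill 1983, Ch. 4, p. 97.
-/

noncomputable section

open Bundle TopologicalSpace Set Module Real Filter
open scoped InnerProductSpace Topology ContDiff Manifold

namespace Literature.Geometry.Lorentzian

namespace Kerr.BL

open Kerr.Ingoing Literature.Analysis.Calculus

variable {M a b ρ₁ : ℝ}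

/-! ### The leaf over the exterior of the threshold -/

/-- Points of `Kerr.slice 0 ρ₁` with `ρ₁ ≥ ρH` are beyond the quasi-isotropic threshold. [cite: BrandtSeidel1996, §II] -/
theorem rhoH_lt_norm (hρ₁ : rhoH M a ≤ ρ₁) (x : slice 0 ρ₁) : rhoH M a < ‖(x : E3)‖ :=
  hρ₁.trans_lt ((le_max_left _ _).trans_lt (mem_slice_zero_iff.1 x.2))

/-- On `Kerr.slice 0 ρ₁`, `ρ₁ ≥ ρH`, `0 ≤ M`: `R(‖x‖) > 0 = max 0 0`. [cite: BrandtSeidel1996, §II] -/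
theorem max_lt_qiRadius (hM : 0 ≤ M) (hρ₁ : rhoH M a ≤ ρ₁) (x : slice 0 ρ₁) :
    max 0 0 < qiRadius M a ‖(x : E3)‖ := by
  rw [max_self]
  exact qiRadius_pos_of_rhoH_lt hM (rhoH_lt_norm hρ₁ x)

variable (M a b ρ₁) in
/-- **The Boyer–Lindquist leaf** over the exterior `{‖x‖ > max ρ₁ 0}` of the quasi-isotropic
threshold, as a map into the ingoing Kerr–Schild chart domain `Kerr.region a 0 = {r > 0}`
(`0 ≤ M`, `ρ₁ ≥ ρH`; base point `b` of the height/twist primitives). Brandt–Seidel 1996, §II;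
Boyer–Lindquist 1967. [cite: BrandtSeidel1996, §II] -/
def leaf (hM : 0 ≤ M) (hρ₁ : rhoH M a ≤ ρ₁) : slice 0 ρ₁ → region a 0 :=
  fun x ↦ ⟨leafRep M a b x,
    leafRep_mem_region M a b (ne_zero_of_mem_slice_zero x) (max_lt_qiRadius hM hρ₁ x)⟩

/-- Unfolding lemma. [cite: BrandtSeidel1996, §II] -/
@[simp] theorem coe_leaf (hM : 0 ≤ M) (hρ₁ : rhoH M a ≤ ρ₁) (x : slice 0 ρ₁) :
    (leaf M a b ρ₁ hM hρ₁ x : E4) = leafRep M a b x := rfl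

/-- **The leaf is `C^∞`** (base point `b > rH`). [cite: BrandtSeidel1996, §II] -/
theorem contMDiff_leaf (hM : 0 ≤ M) (hρ₁ : rhoH M a ≤ ρ₁) (hb : rH M a < b) :
    ContMDiff 𝓘(ℝ, E3) 𝓘(ℝ, E4) ∞ (leaf M a b ρ₁ hM hρ₁) := by
  intro x
  have h1 : ContMDiffAt 𝓘(ℝ, E3) 𝓘(ℝ, E4) ∞ (fun y : slice 0 ρ₁ ↦ leafRep M a b y) x :=
    (OpensChart.contMDiffAt_iff x _ (leafRep M a b) (fun _ ↦ rfl)).2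
      (contDiffAt_leafRep hb (rhoH_lt_norm hρ₁ x))
  exact (ChartedSpace.liftPropWithinAt_subtypeVal_comp_iff (leaf M a b ρ₁ hM hρ₁) Set.univ x).mp h1

/-- **The differential of the leaf is the Fréchet derivative of the leaf map.** [cite: BrandtSeidel1996, §II] -/
theorem mfderiv_leaf_apply (hM : 0 ≤ M) (hρ₁ : rhoH M a ≤ ρ₁) (hb : rH M a < b) (x : slice 0 ρ₁)
    (v : E3) :
    mfderiv 𝓘(ℝ, E3) 𝓘(ℝ, E4) (leaf M a b ρ₁ hM hρ₁) x v = fderiv ℝ (leafRep M a b) x v := by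
  have hd : DifferentiableAt ℝ (leafRep M a b) x :=
    (contDiffAt_leafRep hb (rhoH_lt_norm hρ₁ x)).differentiableAt (by simp)
  have hmd : MDifferentiableAt 𝓘(ℝ, E3) 𝓘(ℝ, E4) (fun y : slice 0 ρ₁ ↦ leafRep M a b y) x :=
    (OpensChart.mdifferentiableAt_iff x _ (leafRep M a b) (fun _ ↦ rfl)).2 hd
  have h1 : mfderiv 𝓘(ℝ, E3) 𝓘(ℝ, E4) (fun y : slice 0 ρ₁ ↦ leafRep M a b y) x =
      fderiv ℝ (leafRep M a b) x :=
    OpensChart.mfderiv_eq x _ (leafRep M a b) (fun _ ↦ rfl) hd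
  rw [OpensChart.mfderiv_codRestrict (φ := leaf M a b ρ₁ hM hρ₁)
    (f := fun y : slice 0 ρ₁ ↦ leafRep M a b y) (fun _ ↦ rfl) hmd, h1]
  rfl

/-! ### The induced metric on the whole slice: continuity across the axis -/

/-- The closed form `blHRep M a · v w` is continuous off the origin when `0 ≤ M` beyond the
threshold (`Σ = R² + a²x₃²/ρ² > 0`). [cite: BrandtSeidel1996, §II] -/
theorem continuousAt_blHRep (hM : 0 ≤ M) {x : E3} (hx : rhoH M a < ‖x‖) (v w : E3) :
    ContinuousAt (fun y : E3 ↦ blHRep M a y v w) x := by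
  have hx0 : x ≠ 0 := by
    intro h0; rw [h0, norm_zero] at hx; exact absurd hx (not_lt.2 (rhoH_nonneg M a))
  have hρ : ‖x‖ ≠ 0 := norm_ne_zero_iff.2 hx0
  have hRpos : 0 < qiRadius M a ‖x‖ := qiRadius_pos_of_rhoH_lt hM hx
  have hS : qiRadius M a ‖x‖ ^ 2 + a ^ 2 * (x 2 / ‖x‖) ^ 2 ≠ 0 := by positivity
  have hn : ContinuousAt (fun y : E3 ↦ ‖y‖) x := continuous_norm.continuousAt
  have hR : ContinuousAt (fun y : E3 ↦ qiRadius M a ‖y‖) x :=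
    (contDiffAt_qiRadius_norm M a hx0 (n := 0)).continuousAt
  have h2 : ContinuousAt (fun y : E3 ↦ y 2) x := (EuclideanSpace.proj (𝕜 := ℝ) (2 : Fin 3)).continuous.continuousAt
  have h0 : Continuous (fun y : E3 ↦ y 0) := (EuclideanSpace.proj (𝕜 := ℝ) (0 : Fin 3)).continuous
  have h1 : Continuous (fun y : E3 ↦ y 1) := (EuclideanSpace.proj (𝕜 := ℝ) (1 : Fin 3)).continuous
  have hμ : ContinuousAt (fun y : E3 ↦ y 2 / ‖y‖) x := h2.div hn hρ
  have hSig : ContinuousAt (fun y : E3 ↦ qiRadius M a ‖y‖ ^ 2 + a ^ 2 * (y 2 / ‖y‖) ^ 2) x :=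
    (hR.pow 2).add (continuousAt_const.mul (hμ.pow 2))
  have hrot : ∀ u : E3, ContinuousAt (fun y : E3 ↦ rotForm y u) x := fun u ↦ by
    unfold rotForm
    exact (((h0.mul continuous_const).sub (h1.mul continuous_const)).continuousAt).div (hn.pow 2)
      (pow_ne_zero 2 hρ)
  unfold blHRep
  exact ((hSig.div (hn.pow 2) (pow_ne_zero 2 hρ)).mul continuousAt_const).add
    (((continuousAt_const.mul ((hSig.add (continuousAt_const.mul hR)))).div hSig hS).mul
      ((hrot v).mul (hrot w)))

/-- **The induced metric of the leaf is `blHRep` at EVERY point of the slice, axis included**: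
both `y ↦ g_{leafRep y}(d leafRep v, d leafRep w)` and `y ↦ blHRep y (v, w)` are continuous on the
open slice and agree off the axis (`bilin_fderiv_leafRep`), hence everywhere
(`Kerr.eqOn_slice_of_offAxis`). Brandt–Seidel 1996, §II. [cite: BrandtSeidel1996, §II] -/
theorem bilin_fderiv_leafRep_of_mem (hM : 0 ≤ M) (hρ₁ : rhoH M a ≤ ρ₁) (hb : rH M a < b)
    (x : slice 0 ρ₁) (v w : E3) :
    Kerr.bilin M a (leafRep M a b x) (fderiv ℝ (leafRep M a b) x v) (fderiv ℝ (leafRep M a b) x w) =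
      blHRep M a x v w := by
  set G : E3 → ℝ := fun y ↦ Kerr.bilin M a (leafRep M a b y) (fderiv ℝ (leafRep M a b) y v)
    (fderiv ℝ (leafRep M a b) y w) - blHRep M a y v w with hG
  have hcont : ContinuousOn G (slice 0 ρ₁) := by
    intro y hy
    have hyρ : rhoH M a < ‖y‖ := rhoH_lt_norm hρ₁ ⟨y, hy⟩
    have hy0 : y ≠ 0 := ne_zero_of_mem_slice_zero ⟨y, hy⟩
    have hsm := contDiffAt_leafRep (M := M) (a := a) hb hyρ
    have hL : ContinuousAt (leafRep M a b) y := hsm.continuousAt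
    have hD : ContinuousAt (fun y ↦ fderiv ℝ (leafRep M a b) y) y :=
      (hsm.fderiv_right (m := 0) (by norm_num)).continuousAt
    have hrad : 0 < radius a (leafRep M a b y) := by
      rw [radius_leafRep M a b hy0 (qiRadius_pos_of_rhoH_lt hM hyρ)]
      exact qiRadius_pos_of_rhoH_lt hM hyρ
    have hB : ContinuousAt (fun y ↦ Kerr.bilin M a (leafRep M a b y)) y :=
      ((contDiffAt_bilin M a hrad (n := 0)).continuousAt).comp hL
    have hBv : ContinuousAt (fun y ↦ Kerr.bilin M a (leafRep M a b y) (fderiv ℝ (leafRep M a b) y v)) y :=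
      hB.clm_apply (hD.clm_apply continuousAt_const)
    have hBvw : ContinuousAt (fun y ↦ Kerr.bilin M a (leafRep M a b y) (fderiv ℝ (leafRep M a b) y v)
        (fderiv ℝ (leafRep M a b) y w)) y :=
      hBv.clm_apply (hD.clm_apply continuousAt_const)
    exact (hBvw.sub (continuousAt_blHRep hM hyρ v w)).continuousWithinAt
  have hoff : ∀ y ∈ slice 0 ρ₁, (y 0 ≠ 0 ∨ y 1 ≠ 0) → G y = 0 := by
    intro y hy hax
    have hyρ : rhoH M a < ‖y‖ := rhoH_lt_norm hρ₁ ⟨y, hy⟩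
    have hR : max 0 0 < qiRadius M a ‖y‖ := max_lt_qiRadius hM hρ₁ ⟨y, hy⟩
    simp only [hG, sub_eq_zero]
    exact bilin_fderiv_leafRep hb hyρ hax hR v w
  have h := eqOn_slice_of_offAxis hcont hoff x x.2
  simpa only [hG, sub_eq_zero] using h

/-- **The induced metric of the leaf** (manifold form): for every `x` in the slice,
`g_{leaf x}(d leaf v, d leaf w) = blHRep x (v, w)`. [cite: BrandtSeidel1996, §II] -/
theorem bilin_mfderiv_leaf (hM : 0 ≤ M) (hρ₁ : rhoH M a ≤ ρ₁) (hb : rH M a < b) (x : slice 0 ρ₁)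
    (v w : E3) :
    Kerr.bilin M a (leaf M a b ρ₁ hM hρ₁ x : E4)
        (mfderiv 𝓘(ℝ, E3) 𝓘(ℝ, E4) (leaf M a b ρ₁ hM hρ₁) x v)
        (mfderiv 𝓘(ℝ, E3) 𝓘(ℝ, E4) (leaf M a b ρ₁ hM hρ₁) x w) = blHRep M a x v w := by
  rw [mfderiv_leaf_apply hM hρ₁ hb, mfderiv_leaf_apply hM hρ₁ hb, coe_leaf]
  exact bilin_fderiv_leafRep_of_mem hM hρ₁ hb x v w

/-! ### The leaf is a spacelike immersion -/

/-- **`blHRep` is positive definite** beyond the threshold for `0 ≤ M`: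
`blHRep(v, v) = (Σ/ρ²)‖v‖² + (a²(Σ + 2MR)/Σ) ϖ(v)² ≥ (Σ/ρ²)‖v‖² > 0` for `v ≠ 0`.
[cite: BrandtSeidel1996, §II] -/
theorem blHRep_pos (hM : 0 ≤ M) {x : E3} (hx : rhoH M a < ‖x‖) {v : E3} (hv : v ≠ 0) :
    0 < blHRep M a x v v := by
  have hx0 : x ≠ 0 := by
    intro h0; rw [h0, norm_zero] at hx; exact absurd hx (not_lt.2 (rhoH_nonneg M a))
  have hρ : 0 < ‖x‖ := norm_pos_iff.2 hx0
  have hR : 0 < qiRadius M a ‖x‖ := qiRadius_pos_of_rhoH_lt hM hx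
  have hS : 0 < qiRadius M a ‖x‖ ^ 2 + a ^ 2 * (x 2 / ‖x‖) ^ 2 := by positivity
  have hvv : 0 < ⟪v, v⟫_ℝ := real_inner_self_pos.2 hv
  unfold blHRep
  have h1 : 0 < (qiRadius M a ‖x‖ ^ 2 + a ^ 2 * (x 2 / ‖x‖) ^ 2) / ‖x‖ ^ 2 * ⟪v, v⟫_ℝ := by positivity
  have h2 : 0 ≤ a ^ 2 * (qiRadius M a ‖x‖ ^ 2 + a ^ 2 * (x 2 / ‖x‖) ^ 2 + 2 * M * qiRadius M a ‖x‖) /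
      (qiRadius M a ‖x‖ ^ 2 + a ^ 2 * (x 2 / ‖x‖) ^ 2) * (rotForm x v * rotForm x v) := by
    have : 0 ≤ rotForm x v * rotForm x v := mul_self_nonneg _
    positivity
  linarith

/-- **The Boyer–Lindquist leaf is a spacelike immersion** into the ingoing Kerr–Schild chart
`(Kerr.region a 0, g_{M,a})` (`0 ≤ M`, `ρ₁ ≥ ρH`, `b > rH`). O'Neill 1983, Ch. 4, p. 97.
[cite: ONeill1983, Ch. 4, p. 97] -/
theorem isSpacelikeImmersion_leaf [Kerr.Facts] (hM : 0 ≤ M) (hρ₁ : rhoH M a ≤ ρ₁) (hb : rH M a < b) :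
    (Kerr.smoothMetric M a 0).IsSpacelikeImmersion 𝓘(ℝ, E3) (leaf M a b ρ₁ hM hρ₁) := by
  refine ⟨contMDiff_leaf hM hρ₁ hb, fun x v hv ↦ ?_⟩
  set w : E3 := v with hw
  have hw0 : w ≠ 0 := hv
  have hgoal : 0 < Kerr.bilin M a (leaf M a b ρ₁ hM hρ₁ x : E4)
      (mfderiv 𝓘(ℝ, E3) 𝓘(ℝ, E4) (leaf M a b ρ₁ hM hρ₁) x w)
      (mfderiv 𝓘(ℝ, E3) 𝓘(ℝ, E4) (leaf M a b ρ₁ hM hρ₁) x w) := by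
    rw [bilin_mfderiv_leaf hM hρ₁ hb x w w]
    exact blHRep_pos hM (rhoH_lt_norm hρ₁ x) hw0
  rw [PseudoRiemannianMetric.inducedBilin_apply, Kerr.smoothMetric_val]
  exact hgoal

end Kerr.BL

end Literature.Geometry.Lorentzian

end
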